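import Literature.IUT.HodgeTheaters.GlobalFrobenioidsCoricKummerNaturality
import Literature.IUT.HodgeTheaters.GlobalFrobenioidsCoricRigidityOfFixedDivisors
import HarnessLib

/-!
# [IUTchI] Example 5.1 (v), pp. 127–128: "unique up to a uniquely determined isomorphism" for the ∞κ-pair
# AT THE GENUINE KUMMER MAP — no Kummer-realisation datum, no naturality law (proof-only)

S. Mochizuki, *Inter-universal Teichmüller theory I*, kurims manuscript (May 2020), §5 Example 5.1 (v), p. 127
l. 57 – p. 128 l. 2 and p. 128 l. 49–54 ([IUTchI] Ex 5.1 (v) pp.127–128) [claim: Mochizuki2012, status: disputed]: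
"by considering the Kummer classes ⊆ `lim_{→ H} H¹(H, μ_Ẑ(†𝕄^⊛_∞κ))` [where `H` ranges over the open
subgroups of `π₁^rat(†𝒟^⊛)`] … the asserted injectivity follows immediately from the corresponding injectivity
in the case of `𝕄^⊛_∞κ(†𝒟^⊚)` … by considering divisors of zeroes and poles … `ℚ_{>0} ∩ Ẑ^× = {1}` … `†ℱ^⊛`
always admits an ∞κ-coric structure, which is, moreover, unique up to a uniquely determined isomorphism".
LANA §6.1 pp. 31–32 [LANA2026Report]: the Kummer map `κ : M → lim_{→ H} H¹(H, Λ(M))`, `G`-equivariant.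

Sub-DAG `plan/L5/SUBDAG-IUTchI-Ex51.md` rows E51/L25 (the container), L26 (injectivity), L27 (a)(b′), L29;
GAP-LEDGER G-w4d056-2; node IUTchI:Ex5.1(v); LAYER-5 certificate row 1116 conjunct 1 ("hnat drop", L5-lead
RULINGS 07:37Z (d)).  PROOF-ONLY: theorems, no definition, no instance, no new `Prop` fact.

**State before this file.**  The closers of record (`existsUniqueCoricStructure_infκPair_of_divisors`, p424116;
`…_of_fixedDivisors`, abc-iut-w5-d110 p431147) take a Kummer-realisation DATUM `κ` of the model pair in an
abstract container `H` [two instance atoms: the `π₁^rat`- and `Ẑ^×`-actions on `H`] and the law (a) `hnat`.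
abc-iut-w4-d056's `GlobalFrobenioidsCoricKummerNaturality.lean` (p431351) made (a) a THEOREM at L2's genuine
`kummerMap`.

**What this file proves** (`NFBridgeRecon.existsUniqueCoricStructure_infκPair_kummerMap`): the boxed
uniqueness `ExistsUniqueCoricStructure π₁^rat 𝕄^⊛_∞κ(†𝒟^⊚)` with the Kummer realisation INTERNAL and GENUINE —
`κ(f) := kummerMap f ∈ lim_{→ i} H¹(S i, Λ(K_rat^×))` (L2 `kummerMap`/`H1Colimit`, any directed exhaustive system
`S` of normal subgroups of `π₁^rat`), the container carrying its NATURAL `π₁^rat`-action (L2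
`CoMorphism.conjColimMulAut`, equivariance `conjColimMulAut_ofAdd_kummerMap`) and its `Ẑ^×`-module structure
(abc-iut-w4-d056's `H1ColimTwistMulAut`) — so that NO datum `κ`, NO container `H`, NO action instance and NO law
(a) is assumed.  The hypotheses are exactly: the structural side conditions (`hcoe`; `K_rat^×` rootable with all
roots of unity; `1 ∈ 𝕄^⊛_∞κ` and `f ∈ 𝕄^⊛_∞κ ⇔ fⁿ ∈ 𝕄^⊛_∞κ` — Rmk 3.1.7 (ii), the definition of ∞κ-coric); the
printed INJECTIVITY of the Kummer map (E51/L26, "the asserted injectivity", here on `K_rat^×`: no element of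
`K_rat^×` other than `1` has trivial Kummer class — Kummer theory of the function fields, `⋂ₙ (K^×)ⁿ = 1`);
(b′) `hord` — `Ẑ^×` acts by multiplication on the integer divisors of the `π₁^rat`-FIXED ∞κ-coric functions whose
genuine Kummer classes it relates ([AbsTopIII] Prop. 1.6 (iii); GAP G-w4d056-2 (b′), the row's only open law);
and Rmk 3.1.7 (i)/(ii) `hpole`/`hex` on the fixed ∞κ-coric functions (THEOREMS at abc-iut-L5-t2's typing:
`CriticalLocus.IsKappaCoric.not_two_poles`, `CriticalLocus.exists_isKappaCoric_two_zeroes`).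
Also `NFBridgeRecon.kummerMap_mk0_realizes` — the genuine Kummer map REALISES the pseudo-monoid structure of
`𝕄^⊛_∞κ` ([IUTchI] §0 p. 33) — and `kummerMap_mk0_smul` — its `π₁^rat`-equivariance on `𝕄^⊛_∞κ`.
The "respectively, ∞κ×" clause is NOT covered (see `GlobalFrobenioidsCoricKummerNaturality.lean`).  No side is
taken on [IUTchIII] Cor. 3.12; nothing of the disputed series is asserted; typed ≠ proved.
-/

namespace Literature.IUT.HodgeTheaters

open ProfiniteGrp ProfiniteGrp.ProfiniteCompletion
open Literature.AnabelianGeometry.EtaleTheta Literature.AnabelianGeometry.EtaleTheta.ZHatLevel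

namespace NFBridgeRecon

variable (N : NFBridgeRecon.{0}) [MulDistribMulAction N.piRat N.Kratˣ] {ι : Type} [Preorder ι]
  [DecidableEq ι] [IsDirectedOrder ι] (S : ι → Subgroup N.piRat) (hS : ∀ ⦃i j : ι⦄, i ≤ j → S j ≤ S i)
  [RootableBy N.Kratˣ ℕ]

/-! ### The genuine Kummer map on `𝕄^⊛_∞κ ⊆ K_rat^×` -/

omit [MulDistribMulAction N.piRat N.Kratˣ] [RootableBy N.Kratˣ ℕ] in
/-- `Units.mk0` is multiplicative on elements of `𝕄^⊛_∞κ` (nonzero rational functions).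
([IUTchI] Ex 5.1 (i) p.124) [claim: Mochizuki2012, status: disputed] -/
theorem mk0_coe_mul (x y : N.infκPair.carrier) (h : (x : N.Krat) * y ≠ 0) :
    Units.mk0 ((x : N.Krat) * y) h =
      Units.mk0 (x : N.Krat) (N.coe_infκPair_ne_zero x) * Units.mk0 (y : N.Krat) (N.coe_infκPair_ne_zero y) :=
  Units.ext rfl

/-- **The genuine Kummer map is additive on the partial products of `𝕄^⊛_∞κ`**: `κ(f g) = κ(f) + κ(g)` whenever
`f g ∈ 𝕄^⊛_∞κ` (L2 `kummerMap_mul`). ([IUTchI] Ex 5.1 (v) p.127) [claim: Mochizuki2012, status: disputed] -/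
theorem kummerMap_mk0_mul (hc : IsExhausted N.Kratˣ S) (x y : N.infκPair.carrier) (h : (x : N.Krat) * y ≠ 0) :
    kummerMap hS hc (Units.mk0 ((x : N.Krat) * y) h) =
      kummerMap hS hc (Units.mk0 (x : N.Krat) (N.coe_infκPair_ne_zero x)) +
        kummerMap hS hc (Units.mk0 (y : N.Krat) (N.coe_infκPair_ne_zero y)) := by
  rw [N.mk0_coe_mul x y h, kummerMap_mul]

/-- **The genuine Kummer map REALISES the pseudo-monoid `𝕄^⊛_∞κ`** ([IUTchI] §0 p. 33: an injection into an
abelian group such that the partial products are exactly the pairs whose product stays in the image, and the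
operation is the restricted group law) — in the multiplicatively written container
`Multiplicative (lim_{→ i} H¹(S i, Λ K_rat^×))`, GIVEN the injectivity of the Kummer map on `K_rat^×` (E51/L26).
PROVED. ([IUTchI] Ex 5.1 (v) p.127) [claim: Mochizuki2012, status: disputed] -/
theorem kummerMap_mk0_realizes (hc : IsExhausted N.Kratˣ S) (hinj : Function.Injective (kummerMap hS hc)) :
    N.infκPair.pm.IsRealizedBy (Multiplicative (H1Colimit N.Kratˣ S hS))
      (fun x => Multiplicative.ofAdd
        (kummerMap hS hc (Units.mk0 (x : N.Krat) (N.coe_infκPair_ne_zero x)))) := by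
  refine ⟨fun x y hxy => ?_, Set.ext fun p => ?_, fun p => ?_⟩
  · have h := hinj (Multiplicative.ofAdd.injective hxy)
    exact Subtype.ext ((Units.val_mk0 (N.coe_infκPair_ne_zero x)).symm.trans
      ((congrArg Units.val h).trans (Units.val_mk0 (N.coe_infκPair_ne_zero y))))
  · change (p.1 : N.Krat) * p.2 ∈ N.Minfκ ↔ _
    constructor
    · intro hp
      refine ⟨⟨(p.1 : N.Krat) * p.2, hp⟩, ?_⟩
      change Multiplicative.ofAdd (kummerMap hS hc (Units.mk0 ((p.1 : N.Krat) * p.2) _)) = _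
      rw [N.kummerMap_mk0_mul S hS hc p.1 p.2, ofAdd_add]
    · rintro ⟨c, hcp⟩
      have hmul : (p.1 : N.Krat) * p.2 ≠ 0 := mul_ne_zero (N.coe_infκPair_ne_zero _) (N.coe_infκPair_ne_zero _)
      have h' : kummerMap hS hc (Units.mk0 (c : N.Krat) (N.coe_infκPair_ne_zero c)) =
          kummerMap hS hc (Units.mk0 ((p.1 : N.Krat) * p.2) hmul) := by
        rw [N.kummerMap_mk0_mul S hS hc p.1 p.2 hmul, ← ofAdd_add] at *
        exact Multiplicative.ofAdd.injective hcp
      have hval : (c : N.Krat) = (p.1 : N.Krat) * p.2 :=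
        (Units.val_mk0 (N.coe_infκPair_ne_zero c)).symm.trans
          ((congrArg Units.val (hinj h')).trans (Units.val_mk0 hmul))
      rw [← hval]
      exact c.2
  · change Multiplicative.ofAdd (kummerMap hS hc (Units.mk0 ((p.1.1 : N.Krat) * p.1.2) _)) = _
    rw [N.kummerMap_mk0_mul S hS hc p.1.1 p.1.2, ofAdd_add]

variable [Nonempty ι] [hN : ∀ i, (S i).Normal]

/-- **`π₁^rat`-EQUIVARIANCE of the genuine Kummer map on `𝕄^⊛_∞κ`** for the natural conjugation action on the
container (L2 `CoMorphism.conjColimMulAut`, "this map is `G`-equivariant with respect to the natural action of `G`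
on `H¹`"): `κ(g · f) = g ⋆ κ(f)`. PROVED. ([IUTchI] Ex 5.1 (v) p.127) [claim: Mochizuki2012, status: disputed] -/
theorem kummerMap_mk0_smul (hcoe : ∀ (g : N.piRat) (a : N.Kratˣ), ((g • a : N.Kratˣ) : N.Krat) = g • (a : N.Krat))
    (hc : IsExhausted N.Kratˣ S) (g : N.piRat) (x : N.infκPair.carrier) :
    Multiplicative.ofAdd (kummerMap hS hc
        (Units.mk0 ((g • x : N.infκPair.carrier) : N.Krat) (N.coe_infκPair_ne_zero _))) =
      CoMorphism.conjColimMulAut S hS g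
        (Multiplicative.ofAdd (kummerMap hS hc (Units.mk0 (x : N.Krat) (N.coe_infκPair_ne_zero x)))) := by
  rw [CoMorphism.conjColimMulAut_ofAdd_kummerMap]
  congr 2
  apply Units.ext
  rw [Units.val_mk0, hcoe, Units.val_mk0]
  rfl

/-! ### Ex. 5.1 (v) uniqueness at the genuine Kummer map -/

/-- **[IUTchI] Ex. 5.1 (v): "`†ℱ^⊛` always admits an ∞κ-coric structure, which is, moreover, unique up to a
uniquely determined isomorphism" — `ExistsUniqueCoricStructure π₁^rat 𝕄^⊛_∞κ(†𝒟^⊚)` AT THE GENUINE KUMMER MAP.**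
For `N` the Ex. 5.1 (i) data (universe `0`), ANY units action compatible with the field action (`hcoe`), ANY
directed exhaustive system `S` of normal subgroups of `π₁^rat` [the open normal subgroups], `K_rat^×` rootable with
a primitive `n`-th root of unity for every `n`, `1 ∈ 𝕄^⊛_∞κ`, `f ∈ 𝕄^⊛_∞κ ⇔ fⁿ ∈ 𝕄^⊛_∞κ` (Rmk 3.1.7 (ii)):
IF the genuine Kummer map `K_rat^× → lim_{→ i} H¹(S i, Λ K_rat^×)` is injective (E51/L26 "the asserted
injectivity"), (b′) `Ẑ^×` acts by multiplication on the integer divisors of `π₁^rat`-fixed ∞κ-coric functions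
`f, f′` whenever `κ(f′) = u · κ(f)` ([AbsTopIII] Prop. 1.6 (iii)), and Rmk 3.1.7 (i)/(ii) hold in divisor form
(`hpole`, `hex`), THEN the boxed uniqueness holds.  The Kummer realisation, its container, both actions and law
(a) are INTERNAL: `κ := kummerMap` realises the pseudo-monoid (`kummerMap_mk0_realizes`), is equivariant
(`kummerMap_mk0_smul`), and satisfies (a) by `infκPair_kummer_natural_of_factor`.  PROVED.
([IUTchI] Ex 5.1 (v) p.128) [claim: Mochizuki2012, status: disputed] -/
theorem existsUniqueCoricStructure_infκPair_kummerMap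
    (hcoe : ∀ (g : N.piRat) (a : N.Kratˣ), ((g • a : N.Kratˣ) : N.Krat) = g • (a : N.Krat))
    (hprim : ∀ n : ℕ, 0 < n → ∃ ζ : N.Krat, IsPrimitiveRoot ζ n) (hc : IsExhausted N.Kratˣ S)
    (h1 : (1 : N.Krat) ∈ N.Minfκ) (hpow : ∀ (f : N.Krat) (n : ℕ), 0 < n → (f ∈ N.Minfκ ↔ f ^ n ∈ N.Minfκ))
    (hinj : Function.Injective (kummerMap hS hc))
    {X : Type*} (ord : X → N.Krat → ℤ)
    (hord : ∀ (u : MulAut (completion (GrpCat.of (Multiplicative ℤ)))) (f f' : N.infκPair.carrier),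
      (∀ g : N.piRat, g • (f : N.Krat) = f) → (∀ g : N.piRat, g • (f' : N.Krat) = f') →
      kummerMap hS hc (Units.mk0 (f' : N.Krat) (N.coe_infκPair_ne_zero f')) =
        H1ColimTwist S hS u (kummerMap hS hc (Units.mk0 (f : N.Krat) (N.coe_infκPair_ne_zero f))) →
      ∀ x : X, u (eta (ord x f)) = eta (ord x f'))
    (hpole : ∀ f' ∈ N.Minfκ, (∀ g : N.piRat, g • f' = f') →
      ∀ x₁ x₂ : X, x₁ ≠ x₂ → ¬ (ord x₁ f' < 0 ∧ ord x₂ f' < 0))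
    (hex : ∃ f ∈ N.Minfκ, (∀ g : N.piRat, g • f = f) ∧
      ∃ x₁ x₂ : X, x₁ ≠ x₂ ∧ 0 < ord x₁ f ∧ 0 < ord x₂ f) :
    ExistsUniqueCoricStructure N.piRat N.infκPair := by
  -- the container `Multiplicative (lim_{→} H¹(S i, Λ K_rat^×))` with its `Ẑ^×`-module structure and its natural
  -- `π₁^rat`-action
  letI actZ : MulAction (MulAut (completion (GrpCat.of (Multiplicative ℤ))))
      (Multiplicative (H1Colimit N.Kratˣ S hS)) := MulAction.compHom _ (H1ColimTwistMulAut (A := N.Kratˣ) S hS)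
  letI actG : MulAction N.piRat (Multiplicative (H1Colimit N.Kratˣ S hS)) :=
    MulAction.compHom _ (CoMorphism.conjColimMulAut (A := N.Kratˣ) S hS)
  -- the GENUINE Kummer realisation of the model ∞κ-pair
  let κ₀ : N.infκPair.KummerRealization (Multiplicative (H1Colimit N.Kratˣ S hS)) :=
    { toFun := fun x => Multiplicative.ofAdd
        (kummerMap hS hc (Units.mk0 (x : N.Krat) (N.coe_infκPair_ne_zero x)))
      realizes := N.kummerMap_mk0_realizes S hS hc hinj
      smul := fun g x => N.kummerMap_mk0_smul S hS hcoe hc g x }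
  refine N.existsUniqueCoricStructure_infκPair_of_fixedDivisors κ₀ ?_ ord ?_ hpole hex
  · -- law (a): THEOREM at the genuine Kummer map (`Φ := ofAdd` is `Ẑ^×`-equivariant by construction)
    exact N.infκPair_kummer_natural_of_factor S hS hcoe hprim hc h1 hpow κ₀ Multiplicative.ofAdd
      (fun _ _ => rfl) (fun _ => rfl)
  · intro u f f' hf hf' h x
    exact hord u f f' hf hf' (Multiplicative.ofAdd.injective h) x

end NFBridgeRecon

end Literature.IUT.HodgeTheaters
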